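import Summits.CriticalPhenomena.PercolationContinuityZ3.Theorems.PercLowPointHalfSpaceQuantitativeBGNWallDefs
import Literature.Probability.LatticeModels.ProdBernoulliCoupling
import Literature.Probability.LatticeModels.IsoradialPercolationProofs
import Literature.Probability.Percolation.HalfSpaceBGN
import Literature.Probability.Percolation.CriticalContinuityProofs
import Literature.Probability.Percolation.IkhlefPonsaingFirstPassageProofs
import HarnessLib

/-!
# `QuantitativeBGN` (stmt-CriticalPhenomena-0913), line `longrange-wall-ghost-bootstrap` — the transfer

Stub `stub_wallTransfer` of the skeleton `Cruxes/QuantitativeBGN/Lines/longrange_wall_ghost_bootstrap.lean`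
(objects in `Theorems/PercLowPointHalfSpaceQuantitativeBGNWallDefs.lean`, namespace `…Theorems.WallGhost`):
a bound `P_{augWall p λ α}(F ≥ n) ≤ B n^{-θ}` on the wall-footprint tail of the AUGMENTED model,
uniform in the bulk density `p < p_c(ℤ³)`, transfers to the ORIGINAL model AT `p_c`:
`P_{p_c}(F ≥ n) ≤ B n^{-θ}`.

* `λ` is removed by the monotone coupling of product measures (`WallTransfer.real_footGe_le_augWall`):
  `bondPercolation (zdGraph 3) p = prodBernoulli (indicator weights)` (`prodBernoulli_indicator_holds`),
  the indicator weights are pointwise `≤ augProb p λ α` for `λ ≥ 0` (`indicator_le_augProb`), and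
  `{F ≥ n}` is increasing and measurable (`isUpperSet_footGe`, `prodBernoulli_real_mono_of_isUpperSet`).
* `p < p_c` is removed by left lower semicontinuity (`WallTransfer.real_criticalProbI_footGe_le`):
  `{F ≥ n} = ⋃_N A_N` increasingly, where `A_N` reads the cluster of `0` with open pairs inside
  `H ∩ Λ_N` only (an open path is finite, `openConnIn_iUnion_of_monotone` of
  `Literature/Probability/Percolation/IkhlefPonsaingFirstPassageProofs.lean`; a footprint
  `≥ n` is witnessed by `n` wall vertices, `WallTransfer.countGe_iUnion_of_monotone`); each `A_N` is
  determined by the finitely many pairs of `Λ_N`, so `p ↦ P_p(A_N)` is continuous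
  (`continuous_bondPercolation_real_of_determinedBy`); as `0 < p_c` (`criticalProb_zd_pos`),
  `P_{p_c}(A_N) = lim_{p ↑ p_c} P_p(A_N) ≤ B n^{-θ}`, and `P_{p_c}(F ≥ n) = sup_N P_{p_c}(A_N)`.

No new definitions (the truncated events are written out over `openConnIn`, `box`).
-/

noncomputable section

namespace Summit.CriticalPhenomena.PercolationContinuityZ3.Theorems

open MeasureTheory Filter Topology
open Literature.Probability.Percolation Literature.Probability.LatticeModels
open Summit.CriticalPhenomena.PercolationContinuityZ3.Theorems.WallGhost
open scoped ENNReal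

namespace WallTransfer

section General

variable {V : Type*}

/-- The event "the cluster of `x` inside `S` has at least `k` vertices in `W`" grows with `S`.
[folklore] -/
theorem countGe_mono {S S' : Set V} (h : S ⊆ S') (W : Set V) (x : V) (k : ℕ∞) :
    {ω : BondConfig V | k ≤ ({v | ω ∈ openConnIn S x v} ∩ W).encard} ⊆
      {ω | k ≤ ({v | ω ∈ openConnIn S' x v} ∩ W).encard} :=
  fun _ hω => hω.trans (Set.encard_le_encard
    (Set.inter_subset_inter_left _ fun v hv => openConnIn_mono h x v hv))

/-- **Exhaustion of the counting event**: for `k : ℕ` and an increasing sequence of domains,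
"the cluster of `x` inside `⋃ₙ Dₙ` has `≥ k` vertices in `W`" is the increasing union over `n` of
"the cluster of `x` inside `Dₙ` has `≥ k` vertices in `W`" (`k` witnesses, each joined to `x` by a
finite open path). [folklore] -/
theorem countGe_iUnion_of_monotone {D : ℕ → Set V} (hD : Monotone D) (W : Set V) (x : V) (k : ℕ) :
    {ω : BondConfig V | (k : ℕ∞) ≤ ({v | ω ∈ openConnIn (⋃ n, D n) x v} ∩ W).encard} =
      ⋃ n, {ω : BondConfig V | (k : ℕ∞) ≤ ({v | ω ∈ openConnIn (D n) x v} ∩ W).encard} := by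
  ext ω
  simp only [Set.mem_setOf_eq, Set.mem_iUnion]
  constructor
  · intro hk
    obtain ⟨t, ht, htk⟩ := Set.exists_subset_encard_eq hk
    have htfin : t.Finite := Set.finite_of_encard_eq_coe htk
    have hev : ∀ v ∈ t, ∀ᶠ n in atTop, ω ∈ openConnIn (D n) x v := by
      intro v hv
      have hv' : ω ∈ openConnIn (⋃ n, D n) x v := (ht hv).1
      rw [openConnIn_iUnion_of_monotone hD, Set.mem_iUnion] at hv'
      obtain ⟨n, hn⟩ := hv'
      exact eventually_atTop.2 ⟨n, fun m hm => openConnIn_mono (hD hm) x v hn⟩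
    obtain ⟨n, hn⟩ := ((eventually_all_finite htfin).2 hev).exists
    refine ⟨n, ?_⟩
    rw [← htk]
    exact Set.encard_le_encard fun v hv => ⟨hn v hv, (ht hv).2⟩
  · rintro ⟨n, hn⟩
    exact countGe_mono (Set.subset_iUnion D n) W x k hn

/-- The counting event for the cluster of `x` inside `S` is determined by the pairs of `S`. [folklore] -/
theorem determinedBy_countGe (S W : Set V) (x : V) (k : ℕ∞) {K : Set (Sym2 V)} (hK : S.sym2 ⊆ K) :
    DeterminedBy {ω : BondConfig V | k ≤ ({v | ω ∈ openConnIn S x v} ∩ W).encard} K := by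
  rw [determinedBy_iff]
  intro ω ω' h
  have hset : {v | ω ∈ openConnIn S x v} = {v | ω' ∈ openConnIn S x v} := by
    ext v
    exact (determinedBy_iff _ _).1 (DCT16.determinedBy_openConnIn S x v hK) ω ω' h
  change k ≤ ({v | ω ∈ openConnIn S x v} ∩ W).encard ↔ k ≤ ({v | ω' ∈ openConnIn S x v} ∩ W).encard
  rw [hset]

/-- Continuity from below in `Measure.real` form: if every member of an increasing sequence of events
has probability `≤ c`, so has the union. [folklore] -/
theorem measureReal_iUnion_le_of_monotone {Ω : Type*} [MeasurableSpace Ω] (μ : Measure Ω)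
    [IsFiniteMeasure μ] {A : ℕ → Set Ω} (hA : Monotone A) {c : ℝ} (h : ∀ N, μ.real (A N) ≤ c) :
    μ.real (⋃ N, A N) ≤ c := by
  rw [measureReal_def, hA.measure_iUnion, ENNReal.toReal_iSup fun N => measure_ne_top μ _]
  exact ciSup_le h

end General

/-! ### Step (i): the monotone coupling removes `λ` -/

/-- `{F ≥ n}` at the origin is measurable (`measurable_halfSpaceFootprint`). [folklore] -/
theorem measurableSet_footGe_zero (n : ℕ) : MeasurableSet (footGe (0 : Site 3) n) := by
  rw [footGe_zero_eq]
  exact measurable_halfSpaceFootprint (MeasurableSet.of_discrete (s := Set.Ici (n : ℕ∞)))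

/-- **Monotone coupling**: `P_p(F ≥ n) ≤ P_{augWall p λ α}(F ≥ n)` for `λ ≥ 0` — bond percolation on
`ℤ³` is the product measure with the indicator weights, which are pointwise below `augProb p λ α`, and
`{F ≥ n}` is increasing. [folklore] -/
theorem real_footGe_le_augWall (p : unitInterval) {lam : ℝ} (hlam : 0 ≤ lam) (α : ℝ) (n : ℕ) :
    (bondPercolation (zdGraph 3) p).real (footGe 0 n) ≤ (augWall p lam α).real (footGe 0 n) := by
  have h := prodBernoulli_real_mono_of_isUpperSet (indicator_le_augProb p hlam α)
    (isUpperSet_footGe 0 n) (measurableSet_footGe_zero n)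
  rwa [prodBernoulli_indicator_holds] at h

/-! ### Step (ii): left lower semicontinuity removes `p < p_c` -/

/-- The half-space is exhausted by its truncations `H ∩ Λ_N`. [folklore] -/
theorem halfSpace_eq_iUnion :
    ({y : Site 3 | 0 ≤ y 0} : Set (Site 3)) = ⋃ N : ℕ, ({y : Site 3 | 0 ≤ y 0} ∩ (box 3 N : Set (Site 3))) := by
  rw [← Set.inter_iUnion, iUnion_coe_box, Set.inter_univ]

/-- The truncations `H ∩ Λ_N` increase with `N`. [folklore] -/
theorem monotone_domH : Monotone fun N : ℕ => ({y : Site 3 | 0 ≤ y 0} ∩ (box 3 N : Set (Site 3))) :=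
  fun _ _ h => Set.inter_subset_inter_right _ (Finset.coe_subset.2 (box_mono 3 h))

/-- **`{F ≥ n} = ⋃_N A_N`**: the footprint event is the increasing union of its truncations `A_N`
(cluster of `0` read with open pairs inside `H ∩ Λ_N` only). [folklore] -/
theorem footGe_zero_eq_iUnion (n : ℕ) :
    footGe (0 : Site 3) n = ⋃ N : ℕ, {ω : BondConfig (Site 3) | (n : ℕ∞) ≤
      ({v | ω ∈ openConnIn ({y : Site 3 | 0 ≤ y 0} ∩ (box 3 N : Set (Site 3))) 0 v} ∩ {v | v 0 = 0}).encard} := by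
  rw [← countGe_iUnion_of_monotone monotone_domH, ← halfSpace_eq_iUnion]
  rfl

/-- The truncations `A_N` increase with `N`. [folklore] -/
theorem monotone_footGeIn (n : ℕ) :
    Monotone fun N : ℕ => {ω : BondConfig (Site 3) | (n : ℕ∞) ≤
      ({v | ω ∈ openConnIn ({y : Site 3 | 0 ≤ y 0} ∩ (box 3 N : Set (Site 3))) 0 v} ∩ {v | v 0 = 0}).encard} :=
  fun _ _ h => countGe_mono (monotone_domH h) _ _ _

/-- `A_N ⊆ {F ≥ n}`. [folklore] -/
theorem footGeIn_subset_footGe (n N : ℕ) :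
    {ω : BondConfig (Site 3) | (n : ℕ∞) ≤
      ({v | ω ∈ openConnIn ({y : Site 3 | 0 ≤ y 0} ∩ (box 3 N : Set (Site 3))) 0 v} ∩ {v | v 0 = 0}).encard} ⊆
      footGe 0 n :=
  fun _ hω => mem_footGe.2 (countGe_mono Set.inter_subset_left _ _ _ hω)

/-- **`A_N` is determined by the pairs of points of `Λ_N`** (a finite set). [folklore] -/
theorem determinedBy_footGeIn (n N : ℕ) :
    DeterminedBy {ω : BondConfig (Site 3) | (n : ℕ∞) ≤
      ({v | ω ∈ openConnIn ({y : Site 3 | 0 ≤ y 0} ∩ (box 3 N : Set (Site 3))) 0 v} ∩ {v | v 0 = 0}).encard}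
      (↑((box 3 N).sym2) : Set (Sym2 (Site 3))) :=
  determinedBy_countGe _ _ _ _ (by
    rw [Finset.coe_sym2, Set.sym2_inter]
    exact Set.inter_subset_right)

/-- **Left lower semicontinuity at `p_c`**: a bound `P_p(F ≥ n) ≤ c` valid for every `p < p_c(ℤ³)`
holds at `p_c` (`P_{p_c}(F ≥ n) = sup_N P_{p_c}(A_N)`, `P_p(A_N)` continuous in `p`, `0 < p_c`).
[folklore] -/
theorem real_criticalProbI_footGe_le (n : ℕ) {c : ℝ}
    (h : ∀ p : unitInterval, (p : ℝ) < criticalProb (zdGraph 3) (0 : Site 3) →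
      (bondPercolation (zdGraph 3) p).real (footGe 0 n) ≤ c) :
    (bondPercolation (zdGraph 3) (criticalProbI 3)).real (footGe 0 n) ≤ c := by
  have hpc : 0 < criticalProb (zdGraph 3) (0 : Site 3) := criticalProb_zd_pos 3 (by norm_num)
  haveI : (𝓝[<] criticalProbI 3).NeBot :=
    nhdsLT_neBot_of_exists_lt ⟨0, show (0 : unitInterval) < criticalProbI 3 by exact_mod_cast hpc⟩
  rw [footGe_zero_eq_iUnion n]
  refine measureReal_iUnion_le_of_monotone _ (monotone_footGeIn n) fun N => ?_
  have hcont := continuous_bondPercolation_real_of_determinedBy (zdGraph 3) (determinedBy_footGeIn n N)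
  refine le_of_tendsto ((hcont.tendsto (criticalProbI 3)).mono_left
    (nhdsWithin_le_nhds (s := Set.Iio (criticalProbI 3))))
    (eventually_nhdsWithin_of_forall fun p hp => ?_)
  have hp' : (p : ℝ) < criticalProb (zdGraph 3) 0 := hp
  exact (measureReal_mono (footGeIn_subset_footGe n N)).trans (h p hp')

end WallTransfer

open WallTransfer in
/-- **stub_wallTransfer.** A bound `P_{augWall p λ α}(F ≥ n) ≤ B n^{-θ}` on the footprint tail of the
augmented model, uniform in `p < p_c(ℤ³)` (`λ ≥ 0`), gives `P_{p_c}(F ≥ n) ≤ B n^{-θ}` for the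
original model at `p_c`: the monotone coupling in `λ` (`real_footGe_le_augWall`) and left lower
semicontinuity in `p` (`real_criticalProbI_footGe_le`). [folklore] -/
theorem stub_wallTransfer : ∀ α lam θ B : ℝ, 0 ≤ lam → (∀ p : unitInterval, (p : ℝ) < criticalProb (zdGraph 3) (0 : Site 3) → ∀ n : ℕ, 1 ≤ n → (augWall p lam α).real (footGe 0 n) ≤ B * (n : ℝ) ^ (-θ)) → ∀ n : ℕ, 1 ≤ n → (bondPercolation (zdGraph 3) (criticalProbI 3)).real (footGe 0 n) ≤ B * (n : ℝ) ^ (-θ) :=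
  fun α _lam _θ _B hlam hB n hn =>
    real_criticalProbI_footGe_le n fun p hp => (real_footGe_le_augWall p hlam α n).trans (hB p hp n hn)

end Summit.CriticalPhenomena.PercolationContinuityZ3.Theorems

end
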